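import Summits.Ventures.ResidMod.Mod2A5bCertificate
import Summits.Ventures.ResidMod.Mod2A5bEulerData
import Summits.Ventures.ResidMod.TateFrames
import HarnessLib

/-!
# Venture ResidMod — the MOD-2 flag, verdict from EULER FACTORS: `L_{q₅}`, `L_{q₃}` (GAL5), `L₂`
# (good reduction at `2` ⟹ the semistable clause), one real Weierstrass point, and the ordinary slot

HONEST FRAMING. Interface file of a COMPUTATION cell (`pub-residmod`); companion of
`Mod2A5bCertificate.lean` (consumer of Boxer–Calegari–Gee–Pilloni 2025, Thm. 8.3.2, the tree's named
fact `bcgp_residuallyA5b_modular_abelianSurface`, taken as the hypothesis `h832`), `Mod2A5bEulerData.lean`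
(GAL5 from Euler-factor parities) and `TateFrames.lean` (frames of `V_ℓ(A)`; bridge B1). NO surface is
claimed modular and nothing is computed here; every datum is a binder. This file only COMPOSES: for a
flagged census row the remaining binders are exactly
* the Weierstrass `2`-torsion frame `F` (MODELLING CLAIM: `A = Jac(X)`, `X` with a rational Weierstrass
  point, `Γ_ℚ` acting on `A[2]` through the permutations of the other five Weierstrass points, §8.1);
* three good Euler factors `L_{q₅}(A,T)`, `L_{q₃}(A,T)`, `L₂(A,T)` (`HasGoodEulerFactorAt`, the
  predicate of [BPPTVY (4.1.5)]; the engines' exact point counts) with `a_{q₅}, b_{q₅}` odd (a Frobenius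
  acting as a `5`-cycle) and `a_{q₃}` odd, `b_{q₃}` even (a Frobenius of order `3` or `6`) — GAL5 — and
  ANY good Euler factor at `2` (good reduction at `2` ⟹ inertia at `2` acts trivially on every
  `V_ℓ(A)`, `ℓ ≠ 2`: the "good OR semistable" clause of hypothesis (3), bridge B1);
* `hcc`: complex conjugations move exactly four of the five Weierstrass points (one real root; CONJ);
* `hord`: every framed dual of `V₂(A)` is ordinary and `2`-distinguished at `v ∣ 2` (Def. 1.8.8; the
  slot ORD(2) ∧ DIST0(2) — VERBATIM from the fact; its derivation from `L₂` ("good ordinary ⟹ ordinary;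
  `2`-distinguished ⟺ `Q₂` not a square", loc. cit. §9.1) is a printed remark NOT in the tree: bridge B2,
  a conditional slot until the LIT seat's fact lands);
and the conclusion is: every framed dual of every `V_p(A)` is `IsAutomorphicAE` — CONDITIONAL on `h832`.

References: [BoxerCalegariGeePilloni2025] arXiv:2502.20645 Thm. 8.3.2, §8.1, Def. 1.8.8, §9.1;
[BrumerEtAl2019] ANT 13 (2019) (4.1.5), Lemma 5.1.5; [SerreTate1968] §1.
-/

noncomputable section

namespace Summit.Ventures.ResidMod

open Equiv Field IsDedekindDomain Polynomial
open scoped NumberField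
open Literature.NumberTheory.GaloisRepresentations Literature.NumberTheory.Automorphic
open Literature.NumberTheory.Automorphic.Paramodular
open Literature.NumberTheory.DiophantineGeometry Literature.NumberTheory.FaltingsSerre
open Literature.AlgebraicGeometry.Motives (AbelianVariety)

/-- **VERDICT (mod-2 flag) from Euler factors, GIVEN Thm. 8.3.2.**  For an abelian surface `A/ℚ`
with a Weierstrass `2`-torsion frame `F`, good Euler factors at odd primes `q₅` (`a, b` odd) and `q₃`
(`a` odd, `b` even) and at `2` (any), complex conjugations moving four Weierstrass points, and the
ordinary-and-`2`-distinguished slot `hord` verbatim: every framed dual of every `V_p(A)` is automorphic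
almost everywhere on `GL₄(𝔸_ℚ)`. GAL5 and the semistable clause are DERIVED in the kernel
(`exists_perm_pow_five_of_eulerData`, `exists_perm_pow_six_of_eulerData`,
`semistableClause_of_hasGoodEulerFactorAt_two`); the frame of `V₂(A)` needed by the former exists
(`exists_isFrameOfTateRep`). CONDITIONAL on `h832`; every datum a binder.
[cite: BoxerCalegariGeePilloni2025, Thm. 8.3.2; §8.1] [cite: BrumerEtAl2019, (4.1.5) p. 1164 and Lemma 5.1.5 p. 1173] -/
theorem modular_of_mod2EulerCertificate (h832 : bcgp_residuallyA5b_modular_abelianSurface)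
    (A : AbelianVariety ℚ) (hA : A.dim = 2) (F : WeierstrassTwoTorsionFrame A)
    {q₅ : ℕ} (hq₅ : q₅.Prime) (hq₅2 : q₅ ≠ 2) {a₅ b₅ : ℤ}
    (hL₅ : A.HasGoodEulerFactorAt q₅ ((lPolynomialOfSurface q₅ a₅ b₅).map (Int.castRingHom ℚ)))
    (ha₅ : Odd a₅) (hb₅ : Odd b₅)
    {q₃ : ℕ} (hq₃ : q₃.Prime) (hq₃2 : q₃ ≠ 2) {a₃ b₃ : ℤ}
    (hL₃ : A.HasGoodEulerFactorAt q₃ ((lPolynomialOfSurface q₃ a₃ b₃).map (Int.castRingHom ℚ)))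
    (ha₃ : Odd a₃) (hb₃ : Even b₃)
    (hcc : ∀ c : absoluteGaloisGroup ℚ, IsComplexConjugation (algebraMap ℚ ℝ) c →
      (F.perm c).support.card = 4)
    {L₂ : ℚ[X]} (hL₂ : A.HasGoodEulerFactorAt 2 L₂)
    (hord : ∀ (b₂ : Module.Basis (Fin 4) ℚ_[2] (A.rationalTateModule 2))
        (r₂ : FramedGaloisRep ℚ (PadicAlgCl 2) 4),
        (∀ g : absoluteGaloisGroup ℚ,
          (r₂ g).val =
            ((LinearMap.toMatrix b₂ b₂ (A.rationalTateRep 2 g⁻¹)).map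
              (algebraMap ℚ_[2] (PadicAlgCl 2))).transpose) →
        ∀ v : HeightOneSpectrum (𝓞 ℚ), ((2 : ℕ) : 𝓞 ℚ) ∈ v.asIdeal →
          r₂.IsOrdinaryPDistinguishedAt v) :
    ∀ (p : ℕ) [Fact p.Prime] (b : Module.Basis (Fin 4) ℚ_[p] (A.rationalTateModule p))
      (r : FramedGaloisRep ℚ (PadicAlgCl p) 4),
      (∀ g : absoluteGaloisGroup ℚ,
        (r g).val =
          ((LinearMap.toMatrix b b (A.rationalTateRep p g⁻¹)).map
            (algebraMap ℚ_[p] (PadicAlgCl p))).transpose) →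
      ∀ (hcpt : isCompact_glFiniteIntegralLevel 4 ℚ) (ι : PadicAlgCl p ≃+* ℂ),
        IsAutomorphicAE ι hcpt r := by
  haveI : Fact (Nat.Prime 2) := ⟨Nat.prime_two⟩
  obtain ⟨c, r₀, hframe⟩ := exists_isFrameOfTateRep hA 2
  have h5 := exists_perm_pow_five_of_eulerData hA F.apply_smul hframe hq₅ hq₅2 hL₅ ha₅ hb₅
  have h36 := exists_perm_pow_six_of_eulerData hA F.apply_smul hframe hq₃ hq₃2 hL₃ ha₃ hb₃
  exact modular_of_mod2Certificate h832 A hA F h5 h36 hcc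
    (semistableClause_of_hasGoodEulerFactorAt_two hA hL₂) hord

end Summit.Ventures.ResidMod

end
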